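import Mathlib.Data.List.Sort
import Summits.Ventures.CertifiedArithmetic.LowPrec.GemmThetaLawCover

/-!
# Letter-dependent symbolic θ-certificates: the generic class generator and fact checker

HONEST FRAMING (venture CertifiedArithmetic / cell `pub-lowprec`, seat gemm, gen 12 → 13): certified
error envelopes and provably optimal rounding/accumulation schemes for low-precision formats under
stated cost models; every table by two implementations; no hardware or vendor claims.

Executable layer (no soundness theorems here) of the kernel plan for paper `gemm.tex` Theorems
t:thetap6 / t:thetapmix (SUP sides, every precision `p` with `2^(p-1) > x_max/2`).  A product
alphabet with its claimed law is a `LawData` record (letters in product-grid units, ψ-tables `B`,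
`S`, full binade `J`, `θ = (th1·M + th0)/thD`, `κ = 2^kb/(B_kb M + S_kb)`, `ρ`, `β_pair`, regime
`M = M₀K`, `K ≥ K₀`).  States live on LEVELS (`Q`: `v = t < 2M`; binade `j ≤ J`:
`v = (M + t)·2^(j+1)`; `top`).  For a level, a sign, a letter, a TARGET code (exact±, or the binade
of spacing `2^e`) and a residue `π mod g`, `mkDom` computes the interval domain (`IDom` of
`GemmThetaLawSymI`) of the free parameter `T` (`t = gT + π`) on which the step lands in that target
— any interval is SOUND, coverage being checked separately (`coverOK`, via `coverChain` of
`GemmThetaLawCover`); `clsOK` decides the seven θ-certificate facts of a class as non-negativity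
of affine forms (capacity, potential, paid ratio `ρ`, free ratio `κ`, and for free moves the pair
table `pairOK`); `lawCheck` is the conjunction over all levels, signs and letters.  Mirrors the
cell's design aid `code/gemm/thetalaw/symsplit_proto.py`; `GemmThetaLawGenE2M1.lean` reproduces
its E2M1² run in the kernel.  Soundness (facts ⇒ `ThetaCertificate`) is the next layer.
-/

namespace Literature.ComputerArithmetic.FloatingPoint

namespace MiniFloat

namespace ThetaLaw

open AForm
/-! ### Laws, levels, target codes -/

/-- A product alphabet with its claimed all-precision law (cell files `alpha.py`, `laws.py`) and the
symbolic regime. [cell, gemm.tex t:thetap6 / t:thetapmix] -/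
structure LawData where
  /-- positive letter magnitudes in product-grid units, increasing -/
  X : List ℕ
  /-- the full binade -/
  J : ℕ
  /-- ψ binade coefficients `B_0 … B_J` -/
  B : List ℤ
  /-- ψ slopes `S_0 … S_J` -/
  S : List ℤ
  /-- `θ·thD = th1·M + th0` -/
  th1 : ℤ
  /-- see `th1` -/
  th0 : ℤ
  /-- see `th1` -/
  thD : ℤ
  /-- `κ = 2^kb / (B_kb·M + S_kb)` -/
  kb : ℕ
  /-- `ρ = rhoN / rhoD` -/
  rhoN : ℤ
  /-- see `rhoN` -/
  rhoD : ℤ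
  /-- `β_pair = betaN / betaD` -/
  betaN : ℤ
  /-- see `betaN` -/
  betaD : ℤ
  /-- `M = 2^(p-1) = M0·K` -/
  M0 : ℤ
  /-- least value of the symbol `K` (or its only value if `fixed`) -/
  K0 : ℤ
  /-- numeric (`K = K0`) instead of symbolic -/
  fixed : Bool
  deriving Repr

/-- Levels of states: the exact region `Q` (`0 ≤ v < 2M`), binade `j` (`v = (M+t)·2^(j+1)`,
`0 ≤ t < M`, `j ≤ J`), and the top vertex (`t = 0` of binade `J+1`). [cell] -/
inductive Lev where
  | Q
  | bin (j : ℕ)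
  | top
  deriving DecidableEq, Repr
/-- Target codes of one accumulation step: exact and negative, exact and non-negative, or rounded in
the binade of spacing `2^e`. [cell] -/
inductive TCode where
  | xneg
  | xpos
  | bin (e : ℕ)
  deriving DecidableEq, Repr
/-- `⌈a/g⌉` for `g > 0`. [folklore] -/
def ceilDiv (a g : ℤ) : ℤ := -((-a) / g)

namespace LawData

variable (L : LawData)

/-- `B_j`. [cell] -/
def Bj (j : ℕ) : ℤ := L.B.getD j 0
/-- `S_j`. [cell] -/
def Sj (j : ℕ) : ℤ := L.S.getD j 0
/-- The signed alphabet `Λ = {0} ∪ X ∪ -X`. [cell] -/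
def lam : List ℤ := 0 :: (L.X.map fun x => (x : ℤ)) ++ L.X.map fun x => -(x : ℤ)
/-- The grid unit of a level (`v = (M + t)·unit`). [cell] -/
def unit : Lev → ℕ
  | Lev.Q => 1
  | Lev.bin j => 2 ^ (j + 1)
  | Lev.top => 2 ^ (L.J + 2)

/-- The range `[tlo, thi]` of the trailing significand `t` of a level, as `K`-affine forms.
[cell] -/
def trange : Lev → AForm × AForm
  | Lev.Q => (const 0, ⟨-1, 2 * L.M0, 0⟩)
  | Lev.bin _ => (const 0, ⟨-1, L.M0, 0⟩)
  | Lev.top => (const 0, const 0)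

/-- The magnitude form of the states of a class: `t = g·T + π`. [cell] -/
def vform (lev : Lev) (g pi : ℕ) : AForm :=
  match lev with
  | Lev.Q => ⟨pi, 0, g⟩
  | _ => ⟨pi * (L.unit lev : ℤ), L.M0 * (L.unit lev : ℤ), g * (L.unit lev : ℤ)⟩

/-- Candidate targets of a step from a level (a letter moves a state by at most one binade in the
regime `2M > x_max`). [cell] -/
def cands : Lev → List TCode
  | Lev.Q => [TCode.xneg, TCode.xpos, TCode.bin 1]
  | Lev.bin 0 => [TCode.xpos, TCode.bin 1, TCode.bin 2]
  | Lev.bin (j + 1) => [TCode.bin (j + 1), TCode.bin (j + 2), TCode.bin (j + 3)]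
  | Lev.top => [TCode.bin (L.J + 1), TCode.bin (L.J + 2)]

/-- The residue modulus `g` of a (level, target) pair: `4` for up-crossings, else `2`. [cell] -/
def gOf (lev : Lev) : TCode → ℕ
  | TCode.bin e => max 2 (2 ^ (e + 1) / L.unit lev)
  | _ => 2

/-- The value range of a target code, as `K`-affine forms. [cell] -/
def tbounds : TCode → AForm × AForm
  | TCode.xpos => (const 0, ⟨-1, 2 * L.M0, 0⟩)
  | TCode.xneg => (⟨1, -2 * L.M0, 0⟩, const (-1))
  | TCode.bin e => (⟨0, L.M0 * 2 ^ e, 0⟩, ⟨-1, 2 * L.M0 * 2 ^ e, 0⟩)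

/-- `max` of two `K`-affine lower bounds, if it is one of them uniformly in `K ≥ K0`. [cell] -/
def maxb (A B : AForm) : Option AForm :=
  if A.b = B.b then some (if B.a ≤ A.a then A else B)
  else
    let big := if B.eval L.K0 0 ≤ A.eval L.K0 0 then A else B
    let sml := if B.eval L.K0 0 ≤ A.eval L.K0 0 then B else A
    if sml.b ≤ big.b then some big else none

/-- `min` of two `K`-affine upper bounds, if it is one of them uniformly in `K ≥ K0`. [cell] -/
def minb (A B : AForm) : Option AForm :=
  if A.b = B.b then some (if A.a ≤ B.a then A else B)
  else
    let small := if A.eval L.K0 0 ≤ B.eval L.K0 0 then A else B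
    let lg := if A.eval L.K0 0 ≤ B.eval L.K0 0 then B else A
    if small.b ≤ lg.b then some small else none

/-- THE CLASS DOMAIN: the `T`-interval (bounds affine in `K`) of the states `t = gT + π` of level
`lev` (optionally only `t = tfix`) whose step by the signed letter `y` lands in the target `tc`;
`none` if empty for every `K` or not expressible. Any answer is sound — coverage is checked by
`coverOK`. [cell] -/
def mkDom (lev : Lev) (y : ℤ) (tc : TCode) (g pi : ℕ) (tfix : Option ℤ) : Option IDom :=
  let tr := match tfix with
    | some t => (const t, const t)
    | none => L.trange lev
  let tlo := tr.1
  let thi := tr.2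
  let n := (L.vform lev g pi).add (const y)
  let gam := n.c
  let bd := L.tbounds tc
  let lo := bd.1
  let hi := bd.2
  if tlo.b % (g : ℤ) ≠ 0 ∨ thi.b % (g : ℤ) ≠ 0 ∨ gam ≤ 0 ∨
      (lo.b - n.b) % gam ≠ 0 ∨ (hi.b - n.b) % gam ≠ 0 then none
  else
    let L1 : AForm := ⟨ceilDiv (tlo.a - pi) g, tlo.b / g, 0⟩
    let U1 : AForm := ⟨(thi.a - pi) / g, thi.b / g, 0⟩
    let L2 : AForm := ⟨ceilDiv (lo.a - n.a) gam, (lo.b - n.b) / gam, 0⟩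
    let U2 : AForm := ⟨(hi.a - n.a) / gam, (hi.b - n.b) / gam, 0⟩
    match L.maxb L1 L2, L.minb U1 U2 with
    | some Lb, some Ub =>
        if Ub.eval L.K0 0 < Lb.eval L.K0 0 ∧ (L.fixed = true ∨ Ub.b ≤ Lb.b) then none
        else some ⟨L.K0, L.fixed, true, Lb.a, Lb.b, Ub.a, Ub.b⟩
    | _, _ => none

end LawData
/-- A symbolic class: level, sign of the state (`1`/`-1`), letter, target code, residue data and the
parameter domain. [cell] -/
structure GCls where
  /-- level of the states -/
  lev : Lev
  /-- sign of the states, `1` or `-1` -/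
  sgn : ℤ
  /-- the letter (signed, grid units) -/
  q : ℤ
  /-- the target code of the step -/
  tc : TCode
  /-- residue modulus: `t = g·T + π` -/
  g : ℕ
  /-- residue -/
  pi : ℕ
  /-- the parameter domain of `(K, T)` -/
  dom : IDom
  deriving Repr

/-- The result of a symbolic step: value form `W` (in the sign frame of the state), its level, its
trailing-significand form, and whether the sign flipped (exact negative). [cell] -/
structure TgtI where
  /-- value form (magnitude frame of the source state) -/
  W : AForm
  /-- level of the result -/
  lev : Lev
  /-- trailing significand form of the result (its magnitude on level `Q`) -/
  tf : AForm
  /-- the result has the opposite sign -/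
  neg : Bool
  deriving Repr

namespace LawData

variable (L : LawData)

/-- The classes of a (level, sign, letter), optionally filtered to residues `π ≡ tpar (mod 2)`
and/or restricted to `t = tfix`. [cell] -/
def classesFor (lev : Lev) (sgn q : ℤ) (tpar : Option ℕ) (tfix : Option ℤ) : List GCls :=
  (L.cands lev).flatMap fun tc =>
    let g := L.gOf lev tc
    (List.range g).filterMap fun pi =>
      if (match tpar with | some r => decide (pi % 2 = r % 2) | none => true) then
        (L.mkDom lev (sgn * q) tc g pi tfix).map fun d => ⟨lev, sgn, q, tc, g, pi, d⟩
      else none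
/-- All levels. [cell] -/
def levels : List Lev := Lev.Q :: (List.range (L.J + 1)).map Lev.bin ++ [Lev.top]
/-- The level of a rounded result of spacing `2^e`. [cell] -/
def levOfE (e : ℕ) : Lev := if e - 1 ≤ L.J then Lev.bin (e - 1) else Lev.top
/-- The binade exponent used in the free-move bound `δ ≤ 2^j`. [cell] -/
def levExp : Lev → ℕ
  | Lev.Q => 0
  | Lev.bin j => j
  | Lev.top => L.J + 1

/-- ψ OF A POSITIVE STATE with trailing-significand form `tf` on level `lev` (the claimed law:
`B_j M + S_j ⌈t/2⌉` on regular binades, `B_J M + S_J t` on the full binade, `(B_J + S_J) M` at the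
top, the value itself on `Q`), if determined on the domain. [cell, laws.py] -/
def psiLevel (lev : Lev) (tf : AForm) (d : IDom) : Option AForm :=
  match lev with
  | Lev.Q => some tf
  | Lev.top =>
      if nonnegOnI d tf && nonnegOnI d (smul (-1) tf) then
        some (hH ((L.Bj L.J + L.Sj L.J) * L.M0))
      else none
  | Lev.bin j =>
      if !(nonnegOnI d tf && nonnegOnI d ((hH L.M0).sub tf)) then none
      else if j = L.J then some ((hH (L.Bj j * L.M0)).add (smul (L.Sj j) tf))
      else match ceilHalf tf with
        | some ch => some ((hH (L.Bj j * L.M0)).add (smul (L.Sj j) ch))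
        | none => none

/-- THE SYMBOLIC STEP: the result of adding a letter so that the magnitude-frame sum is the form
`n`, under the target code. [cell] -/
def target (d : IDom) (n : AForm) : TCode → Option TgtI
  | TCode.xpos =>
      if nonnegOnI d n && nonnegOnI d (((hH (2 * L.M0)).sub n).sub (const 1)) then
        some ⟨n, Lev.Q, n, false⟩
      else none
  | TCode.xneg =>
      if nonnegOnI d ((smul (-1) n).sub (const 1)) &&
          nonnegOnI d (((hH (2 * L.M0)).add n).sub (const 1)) then
        some ⟨n, Lev.Q, smul (-1) n, true⟩
      else none
  | TCode.bin e =>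
      if e < 1 ∨ L.J + 2 < e then none
      else match tryBinadeI d L.M0 n e with
        | some (Tgt.big _ sig) => some ⟨smul (2 ^ e) sig, L.levOfE e, sig.sub (hH L.M0), false⟩
        | _ => none

/-- Closure: the result is a state (its trailing significand lies in the level's range). [cell] -/
def closureOK (d : IDom) (tg : TgtI) : Bool :=
  match tg.lev with
  | Lev.Q => true
  | Lev.top => nonnegOnI d tg.tf && nonnegOnI d (smul (-1) tg.tf)
  | Lev.bin _ => nonnegOnI d tg.tf && nonnegOnI d ((hH L.M0).sub tg.tf)

/-- The form `thD·θ = th0 + th1·M0·K`. [cell] -/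
def thF : AForm := ⟨L.th0, L.th1 * L.M0, 0⟩
/-- The form `B_kb·M + S_kb` (`κ = 2^kb /` it). [cell] -/
def kapF : AForm := ⟨L.Sj L.kb, L.Bj L.kb * L.M0, 0⟩

/-- One entry of the pair table: the step from a successor class is absorbed, or pays for the free
move before it (`2^j' + δ₂ ≤ β_pair · d₂`). [cell] -/
def pairEdgeOK (d1 : ℤ) (c : GCls) : Bool :=
  let n1 := (L.vform c.lev c.g c.pi).add (const (c.sgn * c.q))
  match L.target c.dom n1 c.tc with
  | none => false
  | some tg =>
      let dl := tg.W.sub n1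
      if dl.b ≠ 0 ∨ dl.c ≠ 0 then false
      else
        let delta := dl.a * c.sgn
        L.closureOK c.dom tg &&
          (decide (delta = -c.q) ||
            (let dd := |c.q| - delta
             decide (0 < dd) && decide ((d1 + delta) * L.betaD ≤ L.betaN * dd)))

/-- THE PAIR TABLE of a free move into level `levp` (result `t'` even) with state sign `sgn`: every
step from an even-residue class of `levp`, and from the vertex `t = 0` of the next level, is
absorbed or pays. [cell, gemm.tex fact (7)] -/
def pairOK (levp : Lev) (sgn : ℤ) : Bool :=
  let d1 : ℤ := 2 ^ L.levExp levp
  let succ1 := L.lam.flatMap fun q2 => L.classesFor levp sgn q2 (some 0) none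
  let succ2 := match levp with
    | Lev.bin j =>
        L.lam.flatMap fun q2 =>
          L.classesFor (if j < L.J then Lev.bin (j + 1) else Lev.top) sgn q2 none (some 0)
    | _ => []
  (succ1 ++ succ2).all (L.pairEdgeOK d1)

/-- THE SEVEN FACTS OF ONE CLASS (closure, capacity, potential, paid ratio, free ratio + successor
parity/bound + pair table), decided on the whole parameter domain.
[cell, gemm.tex Thm t:thetap proof] -/
def clsOK (c : GCls) : Bool :=
  let d := c.dom
  let v := L.vform c.lev c.g c.pi
  let n1 := v.add (const (c.sgn * c.q))
  match L.target d n1 c.tc with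
  | none => false
  | some tg =>
      let dl := tg.W.sub n1
      if dl.b ≠ 0 ∨ dl.c ≠ 0 then false
      else
        let delta := dl.a * c.sgn
        let psiV? : Option AForm :=
          if c.sgn = 1 then (match c.lev with
            | Lev.Q => some v
            | _ => L.psiLevel c.lev ⟨c.pi, 0, c.g⟩ d)
          else some v
        let psiW? : Option AForm :=
          if tg.neg then some tg.tf else if c.sgn = 1 then L.psiLevel tg.lev tg.tf d else some tg.W
        match psiV?, psiW? with
        | some psiV, some psiW =>
            L.closureOK d tg &&
              (if delta = -c.q then
                (if c.q < 0 then nonnegOnI d ((smul L.thD psiV).sub (smul (-c.q) L.thF)) else true)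
              else
                let dd := |c.q| - delta
                nonnegOnI d ((psiV.add (const dd)).sub psiW) &&
                  (if dd < 0 then false
                   else if 0 < dd then decide (delta * L.rhoD ≤ L.rhoN * dd)
                   else
                     nonnegOnI d ((smul (2 ^ L.kb) psiV).sub (smul delta L.kapF)) &&
                       (match tg.lev with
                        | Lev.Q => false
                        | _ =>
                          decide (tg.tf.a % 2 = 0 ∧ tg.tf.c % 2 = 0) &&
                            decide (delta ≤ 2 ^ L.levExp tg.lev) && L.pairOK tg.lev c.sgn)))
        | _, _ => false

/-- The classes served for (level, sign, letter). [cell] -/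
def mainClasses (lev : Lev) (sgn q : ℤ) : List GCls := L.classesFor lev sgn q none none

/-- The `s`-interval (`t = 4s + r`) contributed by a class to residue `r (mod 4)`. [cell] -/
def sIv (r : ℕ) (c : GCls) : Option (AForm × AForm) :=
  if c.pi % c.g ≠ r % c.g then none
  else if c.g = 4 then some (⟨c.dom.L0, c.dom.L1, 0⟩, ⟨c.dom.U0, c.dom.U1, 0⟩)
  else if c.g = 2 then
    let cc : ℤ := (((r : ℤ) - c.pi) / 2) % 2
    if c.dom.L1 % 2 ≠ 0 ∨ c.dom.U1 % 2 ≠ 0 then none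
    else some (⟨ceilDiv (c.dom.L0 - cc) 2, c.dom.L1 / 2, 0⟩, ⟨(c.dom.U0 - cc) / 2, c.dom.U1 / 2, 0⟩)
  else none

/-- COVERAGE of (level, sign, letter): per residue `r (mod 4)` the classes' `s`-intervals satisfy
the chain criterion over the whole `t`-range of the level, at every `K`. [cell] -/
def coverOK (lev : Lev) (sgn q : ℤ) : Bool :=
  let cl := L.mainClasses lev sgn q
  let tr := L.trange lev
  (List.range 4).all fun r =>
    if lev = Lev.top ∧ r ≠ 0 then true
    else
      let slo : AForm := if lev = Lev.top then const 0 else ⟨ceilDiv (tr.1.a - r) 4, tr.1.b / 4, 0⟩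
      let shi : AForm := if lev = Lev.top then const 0 else ⟨(tr.2.a - r) / 4, tr.2.b / 4, 0⟩
      let ivs := (cl.filterMap (sIv r)).insertionSort
        fun AB CD => AB.1.eval L.K0 0 ≤ CD.1.eval L.K0 0
      decide (tr.1.b % 4 = 0 ∧ tr.2.b % 4 = 0) && coverChain (kDom L.K0 L.fixed) slo shi ivs

/-- The check of one level: for both signs and every letter, all classes pass and cover. [cell] -/
def levCheck (lev : Lev) : Bool :=
  [1, -1].all fun sgn => L.lam.all fun q => (L.mainClasses lev sgn q).all L.clsOK && L.coverOK lev sgn q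

/-- Side conditions of the symbolic regime (`M₀ > 0` a multiple of 8, `K₀ ≥ 2`, positive
denominators, `x_max < 2M₀K₀`). [cell] -/
def sideOK : Bool :=
  decide (0 < L.M0 ∧ L.M0 % 8 = 0 ∧ 2 ≤ L.K0 ∧ 0 < L.thD ∧ 0 < L.rhoD ∧ 0 < L.betaD) &&
    decide (((L.X.getLast?).getD 0 : ℤ) < 2 * L.M0 * L.K0)

/-- THE WHOLE CERTIFICATE CHECK of a law in its symbolic regime: side conditions and every level.
[cell] -/
def lawCheck : Bool := L.sideOK && L.levels.all L.levCheck

end LawData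

end ThetaLaw

end MiniFloat

end Literature.ComputerArithmetic.FloatingPoint
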